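import Summits.QuantumFields.YangMills.Theorems.BalabanUVNodesN07MinTokensOfCriticalRow
import Summits.QuantumFields.YangMills.Theorems.BalabanUVNodesN07ChartLinFlatLieTok
import Literature.MathematicalPhysics.QuantumFieldTheory.Balaban1983to89.Node00.BgSchemeOfRecordEL
import HarnessLib

/-!
# N07 ∕ K0ᴬ — THE KNIT TOKENS (min) ∧ (c→s) AT THE SCHEME OF RECORD FOR THE LANDAU FAMILY `Kc^L_ρ V := {A ∈ (102) | A + 𝔄(V) real, ‖A + 𝔄(V)‖ < ρ}`,
# MODULO THE ONE ROW (84)+(110) — every other row of ✓`N07MinTokensOfCriticalRow.minTokens_of_row84` DISCHARGED at the record: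
# the energy form is `𝔟(δ, y) := c·ℜ⟪ιδ, Δ_{1,a}(U₀) ιy⟫` and its `γ`-row IS the road's own `hposπ` ([5] Thm 3.12), uniform on the finite lattice

Cell `pub-ymgap`, seat `pub-ymgap-dag-n07-w3` (g29, WIDTH SEAT 3 on N07 [B11] = [15]); helper file keyed `--kind proof --supports stmt-QuantumFields-27238 --as helper` (K0ᴬ road);
count-neutral.  INTENT-2 of the seat.

## What is here

* §1 (finite-dimensional folklore) ★ `exists_pos_mul_norm_sq_le_re_inner` — on a finite-dimensional complex inner-product space, `∀ x ≠ 0, 0 < ℜ⟪x, Tx⟫` ⟹ `∃ γ₀ > 0, ∀ x,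
  γ₀‖x‖² ≤ ℜ⟪x, Tx⟫` (compact unit sphere): the road's pointwise `hposπ` ⟹ a UNIFORM coercivity constant on the lattice of record.
* §2 (GENERIC over `S : BgScheme`) the LANDAU FAMILY over a constraint submodule `C` (at the record: def-Y's ✓`constraint102OfRecord` = (102)∕(109) `{QA = 0, RD*A = 0}`) and
  the real sector `S.evHerm0`: `KcL S C ρ V := {A | A ∈ C ∧ A + S.𝔄 V ∈ S.evHerm0 ∧ ‖A + S.𝔄 V‖ < ρ}` written INLINE (no `def`); `convex_kcL`, `sub_mem_dir_of_kcL` (differences lie in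
  `Dir := C ∩ evHerm0`), `norm_le_of_kcL` (`‖A‖ ≤ ρ + a`), `sol_mem_kcL` ((star_mem) from `𝒜(V) ∈ C`, the Lie token `S.LieTokAt V` and `ε₄ + a ≤ ρ`),
  `sol_add_frakA_mem_evHerm0_of_lieTokAt`.
* §3 (RECORD, frame-free `bgSchemeOfRecord F N K k Ω U₀ …`, ANY `N`, ANY slot `T`) ★★★ `minTokens_ofRecord_landau` — `∃ M γ, 0 ≤ M ∧ 0 < γ ∧` for all scheme numbers with
  `ε₄ + a𝔄 ≤ ρ`, `2(ρ + 2a𝔄) ≤ a₃`, `4·M·B₀·C₄·(ρ + 2a𝔄) < γ`: `S.RegimeTok` → `FrakGSliceTok` → (Lie token on `dom`) → ROW (84)+(110) with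
  `𝔟 V δ y := c·ℜ⟪ιδ, Δ_{1,a} ιy⟫` (`Δ_{1,a}` = `laplaceAOfRecordAt … (hessOpOfRecord128 …)` = the operator of `hposπ`; `ι` any linear identification of the (115)-space with the
  `L²` bond space, e.g. the canonical jet ↦ bond-function reading) ⟹ (min) ∧ (c→s) LITERALLY for `S.chartLin T` and `Kc^L_ρ`.  `M` = finite-dimensional operator norms; `γ` from §1.

## Honest labels

LOCATED-g29-1 (seat bus 2026-08-31): the Landau row `RD*A = 0` in the family is what makes the displayed row (84)+(110) dischargeable — the row's energy form carries (110)'s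
gauge-fixing terms `DRD* + aQ*Q`, which drop out only against tangent directions with `Qδ = 0, RD*δ = 0`; and along residual gauge motions `A^η ∘ chartLin` is constant, so a family
closed under them (such as g28's `Kc♭_ρ`, which carries no gauge condition) cannot carry (c→s) together with (min).  (star_mem) survives the row by def-Y's
✓`bgSchemeOfRecord_sol_mem_constraint102`, (rng) a fortiori (sub-family).
The row (84)+(110) — [15] (78)–(81)∕(84) + (100), (105)–(110) at the record's letters — is DISPLAYED, NOT proved (N07's expansion programme); `RegimeTok` ([5] Thm 3.13, Prop. 4,
(28), (103) inside), `FrakGSliceTok` and the Lie token are the road's standard displayed rows (the last one a THEOREM at `N = 2` in the small: ✓`lieTokAt_bgSchemeOfRecord_two`).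
Per-lattice constants (`M`, `γ` depend on the lattice of record, like g27∕g28's radii); nothing of Bałaban's estimates proved; K0ᴬ ⟨27238⟩ NOT closed; N07 NOT discharged;
COUNT∕K UNMOVED; R4 is the conditional finite-𝕋⁴ rung `BalabanLadder.UV` only; finite torus at fixed `ε` — nothing continuum ∕ OS ∕ Clay.  **The Yang–Mills mass gap is NOT
proved by any of this.**  No `sorry`, no `def`, no `instance ∕ notation ∕ set_option`; standard axioms.
[cite: Balaban1985Variational, Prop. 5 p.294, Prop. 6 (115)–(121) p.295, Prop. 7 p.299, (76) p.289, (82)–(84) p.290, (100)–(111) pp.293–294, (142) p.299; Balaban1985BackgroundPropagators, Thm 3.12 p.421]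
-/

noncomputable section

open Set Metric Filter Topology
open scoped Matrix Matrix.Norms.L2Operator InnerProductSpace

namespace Summit.QuantumFields.YangMills.Theorems.N07MinTokensOfCriticalRowAtRecord

open Literature.MathematicalPhysics.QuantumFieldTheory.Balaban1983to89
open Literature.MathematicalPhysics.QuantumFieldTheory.Balaban1983to89.T4Continuum (T4Family)
open Literature.MathematicalPhysics.QuantumFieldTheory.Balaban1983to89.Node00
open B9AdOrthogonal (herm0)
open B11Eq103H1Complex (SiteL2K BondL2K)
open B11Eq174Chart (Regime)
open B11Prop6Scheme (mapT)
open Summit.QuantumFields.YangMills.Theorems.N07MinTokensOfCriticalRow (minTokens_of_row84)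
open Summit.QuantumFields.YangMills.Theorems.N07ChartLinFlatLieTok (herm0_of_I_smul_mem_lieSU)

/-! ## §1  Pointwise positivity ⟹ uniform coercivity on a finite-dimensional space -/

/-- ★ **UNIFORM COERCIVITY FROM POINTWISE POSITIVITY** on a finite-dimensional complex inner-product space: if `0 < ℜ⟪x, Tx⟫` for every `x ≠ 0`, then
`γ₀‖x‖² ≤ ℜ⟪x, Tx⟫` for some `γ₀ > 0` and all `x` (minimum of the continuous form over the compact unit sphere, homogeneity).  At the record this turns the road's
displayed `hposπ` ([5] Thm 3.12 for the slot in play) into a coercivity constant of the lattice. [folklore] [cite: Balaban1985BackgroundPropagators, Thm 3.12 p.421] -/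
theorem exists_pos_mul_norm_sq_le_re_inner {E : Type*} [NormedAddCommGroup E] [InnerProductSpace ℂ E] [FiniteDimensional ℂ E]
    (T : E →ₗ[ℂ] E) (hpos : ∀ x, x ≠ 0 → 0 < RCLike.re ⟪x, T x⟫_ℂ) :
    ∃ γ₀ : ℝ, 0 < γ₀ ∧ ∀ x, γ₀ * ‖x‖ ^ 2 ≤ RCLike.re ⟪x, T x⟫_ℂ := by
  rcases subsingleton_or_nontrivial E with hE | hE
  · refine ⟨1, one_pos, fun x => ?_⟩
    rw [Subsingleton.elim x 0]; simp
  -- the form is continuous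
  have hTc : Continuous T := T.continuous_of_finiteDimensional
  have hf : Continuous fun x : E => RCLike.re ⟪x, T x⟫_ℂ :=
    RCLike.continuous_re.comp (continuous_id.inner hTc)
  -- minimum over the unit sphere
  have hcpt : IsCompact (sphere (0 : E) 1) := isCompact_sphere 0 1
  have hne : (sphere (0 : E) 1).Nonempty := (NormedSpace.sphere_nonempty).2 zero_le_one
  obtain ⟨u, hu, hmin⟩ := hcpt.exists_isMinOn hne hf.continuousOn
  have hu1 : ‖u‖ = 1 := by simpa using hu
  have hu0 : u ≠ 0 := by
    intro h; rw [h, norm_zero] at hu1; exact zero_ne_one hu1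
  refine ⟨RCLike.re ⟪u, T u⟫_ℂ, hpos u hu0, fun x => ?_⟩
  by_cases hx : x = 0
  · subst hx; simp
  have hxn : 0 < ‖x‖ := norm_pos_iff.2 hx
  -- normalise
  set v : E := ((‖x‖⁻¹ : ℝ) : ℂ) • x with hv
  have hvs : v ∈ sphere (0 : E) 1 := by
    rw [mem_sphere_zero_iff_norm, hv, norm_smul, Complex.norm_real, Real.norm_eq_abs, abs_of_pos (inv_pos.2 hxn),
      inv_mul_cancel₀ hxn.ne']
  have hle : RCLike.re ⟪u, T u⟫_ℂ ≤ RCLike.re ⟪v, T v⟫_ℂ := hmin hvs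
  -- ℜ⟪v, Tv⟫ = ‖x‖⁻² ℜ⟪x, Tx⟫
  have hscal : RCLike.re ⟪v, T v⟫_ℂ = ‖x‖⁻¹ * (‖x‖⁻¹ * RCLike.re ⟪x, T x⟫_ℂ) := by
    rw [hv, map_smul, inner_smul_left, inner_smul_right, Complex.conj_ofReal]
    simp only [RCLike.re_to_complex, Complex.re_ofReal_mul]
  rw [hscal] at hle
  have hx2 : 0 < ‖x‖ ^ 2 := by positivity
  have hmul : RCLike.re ⟪u, T u⟫_ℂ * ‖x‖ ^ 2 ≤ ‖x‖⁻¹ * (‖x‖⁻¹ * RCLike.re ⟪x, T x⟫_ℂ) * ‖x‖ ^ 2 :=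
    mul_le_mul_of_nonneg_right hle hx2.le
  calc RCLike.re ⟪u, T u⟫_ℂ * ‖x‖ ^ 2 ≤ ‖x‖⁻¹ * (‖x‖⁻¹ * RCLike.re ⟪x, T x⟫_ℂ) * ‖x‖ ^ 2 := hmul
    _ = RCLike.re ⟪x, T x⟫_ℂ := by field_simp


/-! ## §2  Generic scheme: the Landau family over a constraint submodule `C` and the real sector `S.evHerm0` -/

section Generic

variable {F : T4Family} {N : ℕ} [NeZero N] {𝒴 𝒵 : Type} [NormedAddCommGroup 𝒴] [NormedSpace ℂ 𝒴] [NormedAddCommGroup 𝒵] [NormedSpace ℂ 𝒵] {K k : ℕ}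
  (S : BgScheme F N 𝒴 𝒵 K k) (C : Submodule ℂ 𝒴)

omit [NeZero N] in
/-- The Lie token at `V` ⟹ the full small field `𝒜(V) + 𝔄(V)` lies in the real sector `S.evHerm0` (✓`herm0_of_I_smul_mem_lieSU` bondwise).
[cite: Balaban1985Variational, (15) p.280, Prop. 6 p.295 (bookkeeping)] -/
theorem sol_add_frakA_mem_evHerm0_of_lieTokAt {V : GaugeField (F.P K) k (SU N)} (h : S.LieTokAt V) : S.sol V + S.𝔄 V ∈ S.evHerm0 :=
  BgScheme.mem_evHerm0_iff.2 fun b => herm0_of_I_smul_mem_lieSU (h b)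

omit [NeZero N] in
/-- **THE LANDAU FAMILY IS CONVEX**: `{A | A ∈ C ∧ A + 𝔄(V) ∈ evHerm0 ∧ ‖A + 𝔄(V)‖ < ρ}` — a complex subspace ∩ a translated real subspace ∩ a translated ball — is `ℝ`-convex
(print's chart (75)–(77): affine constraints and sup-norm balls). [cite: Balaban1985Variational, (75)–(77) p.289, (102) p.293] -/
theorem convex_kcL (V : GaugeField (F.P K) k (SU N)) (ρ : ℝ) :
    Convex ℝ {A : 𝒴 | A ∈ C ∧ A + S.𝔄 V ∈ S.evHerm0 ∧ ‖A + S.𝔄 V‖ < ρ} := by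
  have hset : {A : 𝒴 | A ∈ C ∧ A + S.𝔄 V ∈ S.evHerm0 ∧ ‖A + S.𝔄 V‖ < ρ} =
      ((C.restrictScalars ℝ : Submodule ℝ 𝒴) : Set 𝒴) ∩ ((fun x : 𝒴 => x + S.𝔄 V) ⁻¹' (S.evHerm0 : Set 𝒴)) ∩
        ((fun x : 𝒴 => x + S.𝔄 V) ⁻¹' ball (0 : 𝒴) ρ) := by
    ext A
    simp only [mem_setOf_eq, mem_inter_iff, SetLike.mem_coe, Submodule.restrictScalars_mem, mem_preimage, mem_ball_zero_iff, and_assoc]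
  rw [hset]
  exact ((Submodule.convex _).inter ((Submodule.convex _).translate_preimage_left _)).inter ((convex_ball (0 : 𝒴) ρ).translate_preimage_left _)

omit [NeZero N] in
/-- Differences of points of the Landau family are TANGENT DIRECTIONS ((83): `QδA′ = 0, RD*δA′ = 0`) and real. [cite: Balaban1985Variational, (83) p.290] -/
theorem sub_mem_dir_of_kcL {V : GaugeField (F.P K) k (SU N)} {ρ : ℝ} {A A₂ : 𝒴}
    (hA : A ∈ {A : 𝒴 | A ∈ C ∧ A + S.𝔄 V ∈ S.evHerm0 ∧ ‖A + S.𝔄 V‖ < ρ}) (hA₂ : A₂ ∈ {A : 𝒴 | A ∈ C ∧ A + S.𝔄 V ∈ S.evHerm0 ∧ ‖A + S.𝔄 V‖ < ρ}) :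
    A₂ - A ∈ {δ : 𝒴 | δ ∈ C ∧ δ ∈ S.evHerm0} := by
  obtain ⟨h1, h2, -⟩ := hA
  obtain ⟨h1', h2', -⟩ := hA₂
  refine ⟨C.sub_mem h1' h1, ?_⟩
  have := S.evHerm0.sub_mem h2' h2
  rwa [add_sub_add_right_eq_sub] at this

omit [NeZero N] in
/-- The Landau family lies in the ball `‖A‖ ≤ ρ + a` once `‖𝔄(V)‖ < a`. [cite: Balaban1985Variational, (103)–(104) p.293] -/
theorem norm_le_of_kcL {V : GaugeField (F.P K) k (SU N)} {ρ a : ℝ} (h𝔄 : ‖S.𝔄 V‖ < a) {A : 𝒴}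
    (hA : A ∈ {A : 𝒴 | A ∈ C ∧ A + S.𝔄 V ∈ S.evHerm0 ∧ ‖A + S.𝔄 V‖ < ρ}) : ‖A‖ ≤ ρ + a := by
  obtain ⟨-, -, h3⟩ := hA
  have : ‖A‖ ≤ ‖A + S.𝔄 V‖ + ‖S.𝔄 V‖ := by
    calc ‖A‖ = ‖(A + S.𝔄 V) - S.𝔄 V‖ := by rw [add_sub_cancel_right]
      _ ≤ ‖A + S.𝔄 V‖ + ‖S.𝔄 V‖ := norm_sub_le _ _
  linarith

omit [NeZero N] in
/-- **(star_mem) FOR THE LANDAU FAMILY**: `𝒜(V) ∈ C` (at the record: (109), def-Y's ✓`bgSchemeOfRecord_sol_mem_constraint102`), the Lie token at `V`, the ball (115) `‖𝒜(V)‖ ≤ ε₄`,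
`‖𝔄(V)‖ < a` and `ε₄ + a ≤ ρ` put the fixed point in the family. [cite: Balaban1985Variational, (109) p.294, Prop. 6 (115) p.295] -/
theorem sol_mem_kcL {V : GaugeField (F.P K) k (SU N)} {ρ : ℝ} (hC : S.sol V ∈ C) (hL : S.LieTokAt V) (hsol : ‖S.sol V‖ ≤ S.ε₄) (h𝔄 : ‖S.𝔄 V‖ < S.a)
    (hfit : S.ε₄ + S.a ≤ ρ) : S.sol V ∈ {A : 𝒴 | A ∈ C ∧ A + S.𝔄 V ∈ S.evHerm0 ∧ ‖A + S.𝔄 V‖ < ρ} :=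
  ⟨hC, sol_add_frakA_mem_evHerm0_of_lieTokAt S hL, lt_of_lt_of_le (lt_of_le_of_lt (norm_add_le _ _) (by linarith)) hfit⟩

end Generic


/-! ## §3  The record: frame-free `bgSchemeOfRecord … U₀ …`, any `N`, any slot `T`, the Landau family over `constraint102OfRecord` -/

section Record

variable (F : T4Family) (N : ℕ) [NeZero N] {K : ℕ} (k : ℕ) (Ω : ℕ → Set (Site (F.P K) 0)) (U₀ : GaugeField (F.P K) 0 (SU N))
  [Fact (0 < (F.L : ℝ))] [Fact (0 < (F.P K).eta k)] (levB : PBond (F.P K) k → ℕ) [Fact (0 < c0Rec F K k)] [Fact (∀ c, 0 < wBRec F K k c)] (a : ℝ)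
  (hposb : ∀ x, x ≠ 0 → 0 < RCLike.re ⟪x, laplaceAOfRecord F N k U₀ (QOfRecord F N k U₀) (QflatOfRecord F N k) a x⟫_ℂ)
  (hQ : Function.Surjective (QOfRecord F N k U₀))
  (Gp : SiteL2K ℂ (F.P K).d (fun _ => (F.P K).sitesPerDir 0) (c0Rec F K k) (WRec N) →ₗ[ℂ]
    SiteL2K ℂ (F.P K).d (fun _ => (F.P K).sitesPerDir 0) (c0Rec F K k) (WRec N))
  (Δ2 : BondL2K ℂ (F.P K).d (fun _ => (F.P K).sitesPerDir 0) (c0Rec F K k) (WRec N) →ₗ[ℂ]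
    BondL2K ℂ (F.P K).d (fun _ => (F.P K).sitesPerDir 0) (c0Rec F K k) (WRec N))
  (hposπ : ∀ x, x ≠ 0 → 0 < RCLike.re ⟪x, laplaceAOfRecordAt F N k U₀ (hessOpOfRecord128 F N k U₀ Gp (QflatOfRecord F N k) Δ2)
    (QOfRecord F N k U₀) (QflatOfRecord F N k) a x⟫_ℂ)

/-- ★★★ **THE KNIT TOKENS (min) ∧ (c→s) AT THE SCHEME OF RECORD, LANDAU FAMILY, MODULO THE ONE ROW (84)+(110).**  There are constants `M ≥ 0`, `γ > 0`
of the lattice of record (finite-dimensional operator norms; `γ` = §1's coercivity constant of `Δ_{1,a}(U₀)` — the operator of `hposπ` — times `c`, divided by a norm of the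
chosen identification `ι`) such that for ALL scheme data `dom εC B₀ C₄ a₃ j a𝔄 ε₄`, every radius `ρ` with `ε₄ + a𝔄 ≤ ρ`, `2(ρ + 2a𝔄) ≤ a₃`, `4·M·B₀·C₄·(ρ + 2a𝔄) < γ`, ANY slot `T`,
under the road's standard displayed rows — `S.RegimeTok` (Prop. 6 at every `V ∈ dom`), `FrakGSliceTok` ([15] p.294 «`Q𝔊 = 0, RD*𝔊 = 0`»), the Lie token on `dom` — and THE ROW
(84)+(110) for the family `Kc^L_ρ V = {A ∈ (102) | A + 𝔄(V) ∈ evHerm0, ‖A + 𝔄(V)‖ < ρ}` and the real tangent directions `(102) ∩ evHerm0`, with energy form `c·ℜ⟪ιδ, Δ_{1,a}(U₀) ιy⟫`: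
(min) `𝒜(V)` minimises `A^η ∘ S.chartLin T V` on `Kc^L_ρ V` and (c→s) every minimiser lies in the ball (115) and is fixed by (116)'s map — LITERALLY the door's two tokens.
[cite: Balaban1985Variational, Thm 1 p.279, Prop. 5 p.294, Prop. 6 (115)–(121) p.295, Prop. 7 p.299, (76) p.289, (82)–(84) p.290, (100)–(111) pp.293–294; Balaban1985BackgroundPropagators, Thm 3.12 p.421] -/
theorem minTokens_ofRecord_landau (c : ℝ) (hc : 0 < c)
    (ι : Space115Lit F N K k Ω U₀ ≃ₗ[ℂ] BondL2K ℂ (F.P K).d (fun _ => (F.P K).sitesPerDir 0) (c0Rec F K k) (WRec N)) :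
    ∃ M γ : ℝ, 0 ≤ M ∧ 0 < γ ∧
      ∀ (dom : Set (GaugeField (F.P K) k (SU N))) (εC B₀ C₄ a₃ j a𝔄 ε₄ ρ : ℝ)
        (T : GaugeField (F.P K) k (SU N) → Space115Lit F N K k Ω U₀ → Space115Lit F N K k Ω U₀)
        (S : BgSchemeOnLit F N K k Ω U₀) (_hS : S = bgSchemeOfRecord F N K k Ω U₀ dom levB Gp Δ2 a hposπ hposb hQ εC B₀ C₄ a₃ j a𝔄 ε₄),
        ε₄ + a𝔄 ≤ ρ → 2 * (ρ + a𝔄 + a𝔄) ≤ a₃ → 4 * M * B₀ * C₄ * (ρ + a𝔄 + a𝔄) < γ →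
        S.RegimeTok → FrakGSliceTok F N K k Ω U₀ Gp Δ2 a hposπ hQ → (∀ V ∈ dom, S.LieTokAt V) →
        (∀ V ∈ dom, ∀ A ∈ {A : Space115Lit F N K k Ω U₀ | A ∈ constraint102OfRecord F N K k Ω U₀ ∧ A + S.𝔄 V ∈ S.evHerm0 ∧ ‖A + S.𝔄 V‖ < ρ},
          ∀ δ ∈ {δ : Space115Lit F N K k Ω U₀ | δ ∈ constraint102OfRecord F N K k Ω U₀ ∧ δ ∈ S.evHerm0},
          HasDerivAt (fun t : ℝ => wilsonAction4 (S.chartLin T V (A + t • δ)))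
            (c * RCLike.re ⟪ι δ, laplaceAOfRecordAt F N k U₀ (hessOpOfRecord128 F N k U₀ Gp (QflatOfRecord F N k) Δ2) (QOfRecord F N k U₀) (QflatOfRecord F N k) a
              (ι (A - mapT (S.𝒢 V) 0 (S.W V) (S.J V) (S.𝔄 V) A))⟫_ℂ) 0) →
        (∀ V ∈ dom, IsMinOn (wilsonAction4 ∘ S.chartLin T V)
            {A : Space115Lit F N K k Ω U₀ | A ∈ constraint102OfRecord F N K k Ω U₀ ∧ A + S.𝔄 V ∈ S.evHerm0 ∧ ‖A + S.𝔄 V‖ < ρ} (S.sol V)) ∧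
        (∀ V ∈ dom, ∀ A ∈ {A : Space115Lit F N K k Ω U₀ | A ∈ constraint102OfRecord F N K k Ω U₀ ∧ A + S.𝔄 V ∈ S.evHerm0 ∧ ‖A + S.𝔄 V‖ < ρ},
          IsMinOn (wilsonAction4 ∘ S.chartLin T V)
            {A : Space115Lit F N K k Ω U₀ | A ∈ constraint102OfRecord F N K k Ω U₀ ∧ A + S.𝔄 V ∈ S.evHerm0 ∧ ‖A + S.𝔄 V‖ < ρ} A →
          ‖A‖ ≤ S.ε₄ ∧ mapT (S.𝒢 V) 0 (S.W V) (S.J V) (S.𝔄 V) A = A) := by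
  -- the letters of the energy form, continuous on the finite lattice
  set Λ := laplaceAOfRecordAt F N k U₀ (hessOpOfRecord128 F N k U₀ Gp (QflatOfRecord F N k) Δ2) (QOfRecord F N k U₀) (QflatOfRecord F N k) a with hΛ
  obtain ⟨γ₀, hγ₀, hcoer⟩ := exists_pos_mul_norm_sq_le_re_inner Λ hposπ
  set ιL : Space115Lit F N K k Ω U₀ →L[ℂ] BondL2K ℂ (F.P K).d (fun _ => (F.P K).sitesPerDir 0) (c0Rec F K k) (WRec N) :=
    ι.toContinuousLinearEquiv.toContinuousLinearMap with hιL
  set ιinvL : BondL2K ℂ (F.P K).d (fun _ => (F.P K).sitesPerDir 0) (c0Rec F K k) (WRec N) →L[ℂ] Space115Lit F N K k Ω U₀ :=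
    ι.toContinuousLinearEquiv.symm.toContinuousLinearMap with hιinvL
  set ΛL := LinearMap.toContinuousLinearMap Λ with hΛL
  have hιL_apply : ∀ y, ιL y = ι y := fun y => rfl
  have hιinvL_apply : ∀ x, ιinvL x = ι.symm x := fun x => rfl
  have hΛL_apply : ∀ x, ΛL x = Λ x := fun x => rfl
  set nι : ℝ := ‖ιL‖ with hnι
  set s : ℝ := ‖ιinvL‖ with hs
  have hs1 : 0 < s ^ 2 + 1 := by positivity
  refine ⟨c * nι * (‖ΛL‖ * nι), c * γ₀ / (s ^ 2 + 1), by positivity, by positivity, ?_⟩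
  intro dom εC B₀ C₄ a₃ j a𝔄 ε₄ ρ T S hS hfit hdom hnum hR h𝔊 hL row84
  subst hS
  -- the energy form as a real-linear functional in the second slot
  let 𝔟 : GaugeField (F.P K) k (SU N) → Space115Lit F N K k Ω U₀ → Space115Lit F N K k Ω U₀ →ₗ[ℝ] ℝ := fun _ δ =>
    ((c • (Complex.reCLM.comp (((innerSL ℂ (ι δ)).comp (ΛL.comp ιL)).restrictScalars ℝ))) : Space115Lit F N K k Ω U₀ →L[ℝ] ℝ).toLinearMap
  have h𝔟 : ∀ V δ y, 𝔟 V δ y = c * RCLike.re ⟪ι δ, Λ (ι y)⟫_ℂ := by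
    intro V δ y
    show (c • (Complex.reCLM.comp (((innerSL ℂ (ι δ)).comp (ΛL.comp ιL)).restrictScalars ℝ))) y = _
    simp only [smul_apply, ContinuousLinearMap.comp_apply, ContinuousLinearMap.coe_restrictScalars',
      Complex.reCLM_apply, innerSL_apply_apply, hιL_apply, hΛL_apply, smul_eq_mul, RCLike.re_to_complex]
  -- the norm rows of the letters
  have hιn : ∀ y : Space115Lit F N K k Ω U₀, ‖ι y‖ ≤ nι * ‖y‖ := fun y => by
    have h := ιL.le_opNorm y
    rwa [hιL_apply] at h
  have hback : ∀ y : Space115Lit F N K k Ω U₀, ‖y‖ ≤ s * ‖ι y‖ := fun y => by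
    have h := ιinvL.le_opNorm (ι y)
    rwa [hιinvL_apply, ι.symm_apply_apply] at h
  have hΛn : ∀ x, ‖Λ x‖ ≤ ‖ΛL‖ * ‖x‖ := fun x => by
    have h := ΛL.le_opNorm x
    rwa [hΛL_apply] at h
  -- the rows of the generic knit
  have hM0 : 0 ≤ c * nι * (‖ΛL‖ * nι) := by positivity
  have hM : ∀ V ∈ (bgSchemeOfRecord F N K k Ω U₀ dom levB Gp Δ2 a hposπ hposb hQ εC B₀ C₄ a₃ j a𝔄 ε₄).dom, ∀ δ y,
      |𝔟 V δ y| ≤ c * nι * (‖ΛL‖ * nι) * ‖δ‖ * ‖y‖ := by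
    intro V _ δ y
    rw [h𝔟 V]
    have h5 : ‖ι δ‖ * ‖Λ (ι y)‖ ≤ (nι * ‖δ‖) * (‖ΛL‖ * (nι * ‖y‖)) :=
      mul_le_mul (hιn δ) ((hΛn (ι y)).trans (mul_le_mul_of_nonneg_left (hιn y) (norm_nonneg _))) (norm_nonneg _) (by positivity)
    calc |c * RCLike.re ⟪ι δ, Λ (ι y)⟫_ℂ| = c * |RCLike.re ⟪ι δ, Λ (ι y)⟫_ℂ| := by rw [abs_mul, abs_of_pos hc]
      _ ≤ c * ‖⟪ι δ, Λ (ι y)⟫_ℂ‖ := mul_le_mul_of_nonneg_left (RCLike.abs_re_le_norm _) hc.le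
      _ ≤ c * (‖ι δ‖ * ‖Λ (ι y)‖) := mul_le_mul_of_nonneg_left (norm_inner_le_norm _ _) hc.le
      _ ≤ c * ((nι * ‖δ‖) * (‖ΛL‖ * (nι * ‖y‖))) := mul_le_mul_of_nonneg_left h5 hc.le
      _ = c * nι * (‖ΛL‖ * nι) * ‖δ‖ * ‖y‖ := by ring
  have hγ : ∀ V ∈ (bgSchemeOfRecord F N K k Ω U₀ dom levB Gp Δ2 a hposπ hposb hQ εC B₀ C₄ a₃ j a𝔄 ε₄).dom,
      ∀ δ ∈ {δ : Space115Lit F N K k Ω U₀ | δ ∈ constraint102OfRecord F N K k Ω U₀ ∧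
        δ ∈ (bgSchemeOfRecord F N K k Ω U₀ dom levB Gp Δ2 a hposπ hposb hQ εC B₀ C₄ a₃ j a𝔄 ε₄).evHerm0},
      c * γ₀ / (s ^ 2 + 1) * ‖δ‖ ^ 2 ≤ 𝔟 V δ δ := by
    intro V _ δ _
    rw [h𝔟 V]
    have hco := hcoer (ι δ)
    have hsq : ‖δ‖ ^ 2 ≤ s ^ 2 * ‖ι δ‖ ^ 2 := by
      rw [← mul_pow]; exact pow_le_pow_left₀ (norm_nonneg δ) (hback δ) 2
    calc c * γ₀ / (s ^ 2 + 1) * ‖δ‖ ^ 2 ≤ c * γ₀ / (s ^ 2 + 1) * (s ^ 2 * ‖ι δ‖ ^ 2) := mul_le_mul_of_nonneg_left hsq (by positivity)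
      _ ≤ c * γ₀ / (s ^ 2 + 1) * ((s ^ 2 + 1) * ‖ι δ‖ ^ 2) :=
          mul_le_mul_of_nonneg_left (mul_le_mul_of_nonneg_right (by linarith) (by positivity)) (by positivity)
      _ = c * (γ₀ * ‖ι δ‖ ^ 2) := by field_simp
      _ ≤ c * RCLike.re ⟪ι δ, Λ (ι δ)⟫_ℂ := mul_le_mul_of_nonneg_left hco hc.le
  -- apply the generic knit
  refine minTokens_of_row84 (S := bgSchemeOfRecord F N K k Ω U₀ dom levB Gp Δ2 a hposπ hposb hQ εC B₀ C₄ a₃ j a𝔄 ε₄) (T := T)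
    (Kc := fun V => {A : Space115Lit F N K k Ω U₀ | A ∈ constraint102OfRecord F N K k Ω U₀ ∧
      A + (bgSchemeOfRecord F N K k Ω U₀ dom levB Gp Δ2 a hposπ hposb hQ εC B₀ C₄ a₃ j a𝔄 ε₄).𝔄 V ∈
        (bgSchemeOfRecord F N K k Ω U₀ dom levB Gp Δ2 a hposπ hposb hQ εC B₀ C₄ a₃ j a𝔄 ε₄).evHerm0 ∧
      ‖A + (bgSchemeOfRecord F N K k Ω U₀ dom levB Gp Δ2 a hposπ hposb hQ εC B₀ C₄ a₃ j a𝔄 ε₄).𝔄 V‖ < ρ})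
    (Dir := fun _ => {δ : Space115Lit F N K k Ω U₀ | δ ∈ constraint102OfRecord F N K k Ω U₀ ∧
      δ ∈ (bgSchemeOfRecord F N K k Ω U₀ dom levB Gp Δ2 a hposπ hposb hQ εC B₀ C₄ a₃ j a𝔄 ε₄).evHerm0})
    (𝔟 := 𝔟) (ε' := ρ + a𝔄) hM0 hR ?_ ?_ ?_ ?_ hM hγ ?_ hdom hnum
  · -- (star_mem)
    intro V hV
    obtain ⟨R, hJ, h𝔄⟩ := hR V hV
    exact sol_mem_kcL _ _ (bgSchemeOfRecord_sol_mem_constraint102 F N K k Ω U₀ levB Gp Δ2 a hposπ hposb hQ dom R hJ h𝔄 h𝔊) (hL V hV)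
      (R.solA_mem hJ h𝔄).1 h𝔄 hfit
  · -- convexity
    intro V _; exact convex_kcL _ _ V ρ
  · -- differences are real tangent directions
    intro V _ A hA A₂ hA₂; exact sub_mem_dir_of_kcL _ _ hA hA₂
  · -- the displayed row, rewritten into the energy form
    intro V hV A hA δ hδ
    have h := row84 V hV A hA δ hδ
    rw [← h𝔟 V δ] at h
    convert h using 3
  · -- the family lies in the ball ‖A‖ ≤ ρ + a𝔄
    intro V hV A hA
    exact norm_le_of_kcL _ _ (hR V hV).2.2 hA

end Record

end Summit.QuantumFields.YangMills.Theorems.N07MinTokensOfCriticalRowAtRecord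

end
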